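import Summits.SmoothPoincare4.SmoothPoincare4.Theses.WeylBudget
import Literature.Geometry.Lorentzian.CurvatureNaturality
import Literature.Geometry.Lorentzian.MetricValCongr
import Literature.Geometry.Lorentzian.IsometryProofs
import Literature.Geometry.Lorentzian.LeviCivitaProofs
import Literature.Topology.FourManifolds.KnotFraming
import HarnessLib

/-!
# Route WeylBudget — `RegluablePscGivesPsc` (item stmt-SmoothPoincare4-3209)

Support item of route `WeylBudget` of `SmoothPoincare4`: an ISOMETRIC cork regluing of a
positive-scalar-curvature metric on `S⁴` is a positive-scalar-curvature metric on the homotopy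
4-sphere, i.e. `CorkRegluablePsc → ∀ S : HomotopySphere 4, ∃ γ, ∃ _ : γ.HasLeviCivita,
γ.IsRiemannian ∧ ∀ x, 0 < scal_γ x` (the conclusion is verbatim route PIC's crux `PicPscV2`).

Proof (locality of scalar curvature, O'Neill 1983, Ch. 3, Prop. 3.59; no seam argument is needed).
`CorkRegluablePsc` hands us, for the homotopy sphere `S`, pieces `C`, `V` (smooth 4-manifolds with
boundary, model `𝓡∂ 4`), smooth embeddings `jC, jV` into `S⁴` and `kC, kV` into `S` whose images
cover, a PSC metric `g` on `S⁴` and a Riemannian metric `γ` on `S` with the SAME piece metrics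
`jC^* g = kC^* γ`, `jV^* g = kV^* γ` (pointwise equality of `pullbackBilin`). The witness is `γ`
itself: its Levi-Civita connection exists outright (`PseudoRiemannianMetric.hasLeviCivita`, the
proved fundamental lemma). For a point `x = kC c` (the case `x = kV v` is identical) pull both
metrics back to the piece: `kC^* γ` and `jC^* g` are honest pullback metrics on `C`
(`PseudoRiemannianMetric.comap`; the embeddings are equidimensional immersions, their differentials
injective by `Manifold.IsImmersionAt.mfderiv_injective`, boundary points included), naturality of
the scalar curvature under local diffeomorphisms (`scalarCurvature_comap`) gives
`scal_{kC^*γ}(c) = scal_γ(kC c)` and `scal_{jC^*g}(c) = scal_g(jC c)`, and the two pullback metrics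
have equal values, hence equal scalar curvature (`scalarCurvature_congr_of_val_eq`). So
`scal_γ(kC c) = scal_g(jC c) > 0`.

References: B. O'Neill, *Semi-Riemannian geometry* (1983), Ch. 3, Thm. 3.11, Prop. 3.59
[ONeill1983]; A. Besse, *Einstein manifolds* (1987), 1.159 ff. [Besse1987].
Everything is proved; no definition, no named fact.
-/

noncomputable section

-- the registered namespace `Summit.SmoothPoincare4.SmoothPoincare4.Theorems` repeats a component
set_option linter.dupNamespace false

open scoped Manifold ContDiff Topology
open Set Function
open Literature.Geometry.Lorentzian

namespace Summit.SmoothPoincare4.SmoothPoincare4.Theorems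

/-- **Transport of positive scalar curvature through a common piece.** Let `P` (model `J`) and `X`
(model `IX`) be smooth manifolds over the same model vector space `EM`, carrying smooth metrics `g`
and `γ`, and let `N` (model `I'`, possibly with boundary, model space `EN` of the same dimension) map
into both by smooth maps `j : N → P`, `k : N → X` with everywhere injective differentials. If the
pullbacks agree, `j^* g = k^* γ` pointwise on `N`, then `scal_γ (k c) = scal_g (j c)` for every
`c : N`. O'Neill 1983, Ch. 3, Prop. 3.59 (local isometries preserve curvature), applied to the two
local isometries `(N, j^*g) → (P, g)` and `(N, k^*γ) → (X, γ)`. [cite: ONeill1983, Ch. 3, Prop. 3.59] -/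
theorem scalarCurvature_eq_of_pullbackBilin_eq
    {EM : Type*} [NormedAddCommGroup EM] [NormedSpace ℝ EM] [FiniteDimensional ℝ EM]
    [CompleteSpace EM]
    {HP : Type*} [TopologicalSpace HP] {J : ModelWithCorners ℝ EM HP}
    {P : Type*} [TopologicalSpace P] [ChartedSpace HP P] [IsManifold J ∞ P]
    {HX : Type*} [TopologicalSpace HX] {IX : ModelWithCorners ℝ EM HX}
    {X : Type*} [TopologicalSpace X] [ChartedSpace HX X] [IsManifold IX ∞ X]
    {EN : Type*} [NormedAddCommGroup EN] [NormedSpace ℝ EN] [FiniteDimensional ℝ EN]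
    [CompleteSpace EN]
    {HN : Type*} [TopologicalSpace HN] {I' : ModelWithCorners ℝ EN HN}
    {N : Type*} [TopologicalSpace N] [ChartedSpace HN N] [IsManifold I' ∞ N]
    (g : PseudoRiemannianMetric J ∞ EM (TangentSpace J : P → Type _)) [g.HasLeviCivita]
    (γ : PseudoRiemannianMetric IX ∞ EM (TangentSpace IX : X → Type _)) [γ.HasLeviCivita]
    {j : N → P} {k : N → X} (hj : ContMDiff I' J ∞ j) (hk : ContMDiff I' IX ∞ k)
    (hj' : ∀ c, Injective (mfderiv I' J j c)) (hk' : ∀ c, Injective (mfderiv I' IX k c))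
    (hdim : Module.finrank ℝ EN = Module.finrank ℝ EM)
    (hval : ∀ c, pullbackBilin (I := J) (I' := I') j g.val c =
      pullbackBilin (I := IX) (I' := I') k γ.val c)
    (c : N) : γ.scalarCurvature (k c) = g.scalarCurvature (j c) := by
  -- the two honest pullback metrics on the piece `N`
  set gN := g.comap (PseudoRiemannianMetric.contMDiff_pullbackBilin_holds
    (I := J) (M := P) (I' := I') (N := N)) j hj hj' hdim with hgN
  set γN := γ.comap (PseudoRiemannianMetric.contMDiff_pullbackBilin_holds
    (I := IX) (M := X) (I' := I') (N := N)) k hk hk' hdim with hγN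
  haveI := gN.hasLeviCivita
  haveI := γN.hasLeviCivita
  -- they have the same values
  have hvals : ∀ u : N, gN.val u = γN.val u := fun u ↦ hval u
  have h1 : gN.scalarCurvature c = g.scalarCurvature (j c) :=
    PseudoRiemannianMetric.scalarCurvature_comap g _ hj hj' hdim c
  have h2 : γN.scalarCurvature c = γ.scalarCurvature (k c) :=
    PseudoRiemannianMetric.scalarCurvature_comap γ _ hk hk' hdim c
  rw [← h2, ← h1]
  exact (PseudoRiemannianMetric.scalarCurvature_congr_of_val_eq hvals c).symm

/-- **Settles item stmt-SmoothPoincare4-3209** (`RegluablePscGivesPsc`, support of route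
`WeylBudget`): if every homotopy 4-sphere is an isometric cork regluing of a PSC metric on `S⁴`
(`CorkRegluablePsc`), then every homotopy 4-sphere carries a Riemannian metric with Levi-Civita
connection and everywhere positive scalar curvature — namely the reglued metric `γ` itself, whose
scalar curvature at `kC c` (resp. `kV v`) equals that of `g` at `jC c` (resp. `jV v`) by
`scalarCurvature_eq_of_pullbackBilin_eq`. [folklore] -/
theorem regluablePscGivesPsc_proof :
    Summit.SmoothPoincare4.SmoothPoincare4.Theses.WeylBudget.RegluablePscGivesPsc := by
  unfold Summit.SmoothPoincare4.SmoothPoincare4.Theses.WeylBudget.RegluablePscGivesPsc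
  intro hP S
  obtain ⟨C, _, _, _, V, _, _, _, jC, jV, kC, kV, g, γ, -, -, hjC, hjV, -, -, hkC, hkV, hkcov, -,
    hpullC, hpullV, -, hγ, _hLC, hscal⟩ := hP S
  haveI hγLC : γ.HasLeviCivita := γ.hasLeviCivita
  refine ⟨γ, hγLC, hγ, fun x ↦ ?_⟩
  have hne : (∞ : ℕ∞ω) ≠ 0 := by simp
  have hx : x ∈ Set.range kC ∪ Set.range kV := by rw [hkcov]; exact Set.mem_univ x
  rcases hx with ⟨c, rfl⟩ | ⟨v, rfl⟩
  · rw [scalarCurvature_eq_of_pullbackBilin_eq g γ hjC.contMDiff hkC.contMDiff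
      (fun c ↦ Literature.Topology.FourManifolds.Manifold.IsImmersionAt.mfderiv_injective
        (hjC.isImmersion.isImmersionAt c) hne)
      (fun c ↦ Literature.Topology.FourManifolds.Manifold.IsImmersionAt.mfderiv_injective
        (hkC.isImmersion.isImmersionAt c) hne)
      rfl hpullC c]
    exact hscal (jC c)
  · rw [scalarCurvature_eq_of_pullbackBilin_eq g γ hjV.contMDiff hkV.contMDiff
      (fun v ↦ Literature.Topology.FourManifolds.Manifold.IsImmersionAt.mfderiv_injective
        (hjV.isImmersion.isImmersionAt v) hne)
      (fun v ↦ Literature.Topology.FourManifolds.Manifold.IsImmersionAt.mfderiv_injective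
        (hkV.isImmersion.isImmersionAt v) hne)
      rfl hpullV v]
    exact hscal (jV v)

end Summit.SmoothPoincare4.SmoothPoincare4.Theorems

end
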